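import Summits.BirchSwinnertonDyer.BirchSwinnertonDyer.Theorems.TwoAdicConverseOrdLambdaHalfAtTwoThetaDatumKernel
import Summits.BirchSwinnertonDyer.BirchSwinnertonDyer.Theorems.TwoAdicConverseLambdaHalfBridge
import Literature.NumberTheory.EllipticCurves.Rank1Residual.GVParityTwistProofs
import Literature.NumberTheory.EllipticCurves.HeegnerPointsKolyvaginExceptionalTwistProofs
import Literature.NumberTheory.EllipticCurves.PAdicLFunctionNeZeroHoldsProofs
import HarnessLib

/-!
# Route `TwoAdicConverse` (rung S3), crux `OrdLambdaHalfAtTwo` (item stmt-BirchSwinnertonDyer-19556), line `kato_determinant_greenberg_two`: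
# the research stub 6‴ `ThetaShapiroGreenbergDivisibilityAtTwo` FOLLOWS FROM the crux on habitat (β) — with NO print input

Seat `cruxlead-stmt-BirchSwinnertonDyer-19556` g5 (LEAD PROVER, MODE LINE; `--supports` stmt-BirchSwinnertonDyer-19556, helper).  THEOREMS ONLY
(no definition, no named fact, no instance, no `sorry`).  HONEST FRAMING (cell `bsd-2adic`): BSD is not proved by any of this; the crux is NOT proved here;
nothing here is progress ON 6‴ — it is the kernel certificate of the lead's verdict «6‴ is crux-sized».

The line's skeleton (`Cruxes/OrdLambdaHalfAtTwo/Lines/kato_determinant_greenberg_two.lean`, v4.8/v4.9) proves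
«crux ∣(β) ⟸ 6‴ + PRINT {PUB, FW, the Kato/fine bundle}».  This file proves the CONVERSE with no print at all:

* `thetaShapiroGreenbergDivisibilityAtTwo_of_lambdaHalfAtTwo_on_beta` — if the `λ`-half `LambdaHalfAtTwo W` holds for every non-CM, good-ordinary-at-`2`,
  globally minimal `W/ℚ` with `E[2]` REDUCIBLE (= the crux `OrdLambdaHalfAtTwo` restricted to habitat (β), item 19218's leaf text), then
  `ThetaShapiroGreenbergDivisibilityAtTwo` holds.  Proof: datum by datum 6‴ is `lam L₀ + lam L₀' ≤ λ(X(E/ℚ_∞)) + λ(X(E^K/ℚ_∞))`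
  (`ThetaShapiroKatoGreenbergDatum.gD_le_lambda_iff`, kernel since v4.5); the binder's twist `A` (a globally minimal model of `E^{(d_K)}`) is again
  non-CM (`j` is a twist invariant), good ordinary at `2` (the binder carries `IsOrdinaryAt A 2`, which IS `GoodOrd A 2`) and has REDUCIBLE `A[2]`
  (`Rank1Residual.not_hasIrreducibleModPGaloisRep_twist`: a quadratic twist moves the rational `2`-torsion line along the twist isomorphism); the
  leaf is scalar-free (`TwoAdicTwistConverse.lambdaHalfAtTwo_iff_forall`), so it applies to the binder's own lifts `L₀`, `L₀'` (non-zero by Rohrlich).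
* `thetaShapiroGreenbergDivisibilityAtTwo_of_ordLambdaHalfAtTwo` — in particular the crux itself (route decl, BY NAME) implies 6‴.

CONSEQUENCE (read with the skeleton): modulo the line's PRINT stubs, 6‴ ⟺ crux ∣(β); the line `kato_determinant_greenberg_two` is a REFORMULATION
of the crux on (β) in Kato-determinant / Greenberg coordinates (its value is the ACCESS it types — `gD = λ⁺ + λ(Λ⧸(L₀,L₀'))`, the GL(1) sandwich,
the Shapiro/`θ` bookkeeping — not a reduction of logical strength).  PARTITION (D-0054): none — RANK axis S3 × X5@2 stratum (β); closes none.
-/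

set_option linter.dupNamespace false
set_option autoImplicit false

noncomputable section

open scoped Classical NumberField MatrixGroups ModularForm
open WeierstrassCurve NumberField IsDedekindDomain Field CongruenceSubgroup
open Literature.NumberTheory.EllipticCurves Literature.NumberTheory.EllipticCurves.Rank1Residual
  Literature.NumberTheory.EllipticCurves.ModularForms
open Summit.BirchSwinnertonDyer.Rank1Residual.X1.MuLambda (lam)
open Summit.BirchSwinnertonDyer.BirchSwinnertonDyer.Theorems.TwoAdicTwistConverse (LambdaHalfAtTwo lambdaHalfAtTwo_iff_forall)

namespace Summit.BirchSwinnertonDyer.BirchSwinnertonDyer.Theorems.TwoAdicKatoDeterminant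

/-- **A globally minimal model of a quadratic twist of a non-CM curve is non-CM** (`j(C • A) = j(A)`, `j(W^{(d)}) = j(W)`).
[cite: SilvermanAEC2009, X.5 Cor. 5.4 and App. C §11] -/
theorem not_hasCM_of_smul_eq_quadraticTwist {W A : WeierstrassCurve ℚ} [W.IsElliptic] [A.IsElliptic] (hCM : ¬ W.HasCM)
    {d : ℚ} (hd : d ≠ 0) {C : VariableChange ℚ} (hA : C • A = W.quadraticTwist d) : ¬ A.HasCM := by
  intro hA'
  haveI := W.isElliptic_quadraticTwist hd
  have h1 : (C • A).HasCM := hasCM_variableChange A C hA'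
  rw [hA] at h1
  exact hCM ((hasCM_iff_of_j_eq (W.j_quadraticTwist hd)).mp h1)

/-- **6‴ ⟸ the `λ`-half on habitat (β)** (no print input).  If `LambdaHalfAtTwo W` holds for every non-CM, good-ordinary-at-`2`, globally minimal
`W/ℚ` with REDUCIBLE `E[2]`, then `ThetaShapiroGreenbergDivisibilityAtTwo`: at each re-keyed Shapiro datum the inequality `gD ≤ λ(X_Gr)` is
`lam L₀ + lam L₀' ≤ λ(X(E/ℚ_∞)) + λ(X(E^K/ℚ_∞))` (`gD_le_lambda_iff`), and both summands are instances of the hypothesis — for `W`, and for the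
binder's minimal twist model `A` of `E^{(d_K)}` (non-CM, `GoodOrd A 2 = IsOrdinaryAt A 2`, `A[2]` reducible by `not_hasIrreducibleModPGaloisRep_twist`),
through the scalar-free form of the leaf (`lambdaHalfAtTwo_iff_forall`) at the binder's own lifts `L₀`, `L₀'` (non-zero: Rohrlich).
[cite: GreenbergVatsal2000, §2 (shape: λ-invariants of a congruent pair)] [cite: SilvermanAEC2009, X.5 Cor. 5.4] [cite: RohrlichInventiones1984, Theorem (p. 409)] -/
theorem thetaShapiroGreenbergDivisibilityAtTwo_of_lambdaHalfAtTwo_on_beta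
    (hβ : ∀ (W : WeierstrassCurve ℚ) [W.IsElliptic] [W.IsGloballyMinimal],
      ¬ W.HasCM → GoodOrd W 2 → ¬ W.HasIrreducibleModPGaloisRep 2 → LambdaHalfAtTwo W) :
    ThetaShapiroGreenbergDivisibilityAtTwo := by
  intro W _ _ hCM hGO hred κ γ hκ hγ hγ' hord _ f hf D L₀ hL₀ K _ _ hK A _ _ C hA hordA _ g hg DA L₀' hL₀' w hw κK γK hκK hγK
    DGr Dfi hcot _ _ v γᵥ hsurj hγᵥ I_W I_A J J' J_A uA S
  rw [S.gD_le_lambda_iff hcot]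
  have hd : ((NumberField.discr K : ℤ) : ℚ) ≠ 0 := by exact_mod_cast NumberField.discr_ne_zero K
  -- the `W`-side: the leaf at the binder's own lift `L₀` (scalar `c = 1`)
  have hL₀0 : L₀ ≠ 0 := by
    rintro rfl
    exact padicLFunction_unitRoot_ne_zero hord hf (by rw [← hL₀, map_zero])
  have hL₀1 : iwasawaToPowerSeries 2 L₀ = PowerSeries.C ((1 : ℚ) : ℚ_[2]) * padicLFunction f (unitRoot W 2 : ℚ_[2]) := by
    rw [hL₀, Rat.cast_one, map_one, one_mul]
  have h1 : lam L₀ ≤ D.lambda :=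
    (lambdaHalfAtTwo_iff_forall W).mp (hβ W hCM hGO hred) κ γ hκ hγ hγ' hord f hf D 1 L₀ hL₀0 hL₀1
  -- the `A`-side: `A` is on habitat (β) too
  have hCMA : ¬ A.HasCM := not_hasCM_of_smul_eq_quadraticTwist hCM hd hA
  have hGOA : GoodOrd A 2 := hordA
  have hredA : ¬ A.HasIrreducibleModPGaloisRep 2 := not_hasIrreducibleModPGaloisRep_twist hred hd A C hA
  have hL₀'0 : L₀' ≠ 0 := by
    rintro rfl
    exact padicLFunction_unitRoot_ne_zero hordA hg (by rw [← hL₀', map_zero])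
  have hL₀'1 : iwasawaToPowerSeries 2 L₀' = PowerSeries.C ((1 : ℚ) : ℚ_[2]) * padicLFunction g (unitRoot A 2 : ℚ_[2]) := by
    rw [hL₀', Rat.cast_one, map_one, one_mul]
  have h2 : lam L₀' ≤ DA.lambda :=
    (lambdaHalfAtTwo_iff_forall A).mp (hβ A hCMA hGOA hredA) κ γ hκ hγ hγ' hordA g hg DA 1 L₀' hL₀'0 hL₀'1
  omega

/-- **6‴ ⟸ the crux `OrdLambdaHalfAtTwo` itself** (route decl, BY NAME; no print input): the crux is the `λ`-half for EVERY non-CM good-ordinary-at-`2`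
curve, in particular on habitat (β) (`LambdaHalfAtTwo W` is its per-curve text).  With the skeleton's «crux ∣(β) ⟸ 6‴ + PRINT» this shows that, modulo the
line's print stubs, 6‴ and the crux on (β) are EQUIVALENT. [cite: GreenbergVatsal2000, §2 (shape)] -/
theorem thetaShapiroGreenbergDivisibilityAtTwo_of_ordLambdaHalfAtTwo
    (h : Summit.BirchSwinnertonDyer.BirchSwinnertonDyer.Theses.TwoAdicConverse.OrdLambdaHalfAtTwo) :
    ThetaShapiroGreenbergDivisibilityAtTwo :=
  thetaShapiroGreenbergDivisibilityAtTwo_of_lambdaHalfAtTwo_on_beta fun W _ _ hCM hGO _ ↦ h W hCM hGO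

end Summit.BirchSwinnertonDyer.BirchSwinnertonDyer.Theorems.TwoAdicKatoDeterminant

end
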